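import Literature.NumberTheory.GelbartRogawski1991.DoubledKroneckerConjugationUndoubled
import Literature.NumberTheory.GelbartRogawski1991.DoubledKroneckerConjugationFrame
import Literature.NumberTheory.GelbartRogawski1991.DoubledWeilRepresentationUndoublingConjOmega
import HarnessLib

/-!
# The Kronecker operator identity `hω` for the χ-attached splittings under a rational change of `V`-frame — MODEL instantiation
# (cell `hodgecm-mathlib`, GS-6 (β) node (T), piece (4) `hω_of_T4` — model half; wave 2, over the (T1ᴰ) lineage
# `DoubledKroneckerConjugation{,Theta,Undoubled,Frame}` (DAG F-a → {F-b → F-c, F-d}); placement row L-13b (4))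

Setting: the (T1ᴰ) MODEL of the doubled conjugation datum — CM field `L`, frames `dV, dV′ : Fin N → L` related by an adelic isometry
`a` (`ha`), rational (`a = a₀ ⊗ 1`, `haa₀`), a rational relabelling `C` of the Kronecker Gram matrices (`hC`, `hCC₀`), and from these
`θ^𝔻 = Ad((a ⊗ 1) ⊕ (a ⊗ 1))` (`thetaD`), Weil's Θ-fixing lifts `r^𝔻 = rD`, `rKron`, `r = reindex_e rKron`, `r⁻ = rneg` with
`thetaD_inlG` (u1), `r_square` (the see-saw square), `proj_undoubleIdx_rD` (`π(undoubleIdx r^𝔻) = π(r) ⊕ π(r⁻)`).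

* §3 **`chiSplitting_eq_conjSplitting_model`** — from the (T4) equality at the model datum
  (`conjSplitting r^𝔻 (relabCD e C) _ (doubledWeilRep[dV] χ ∘ θ^𝔻) = doubledWeilRep[dV′] χ`, hypothesis `hT4`),
  `χSplitting[dV′] g′ = conjSplitting r (relabC e C) _ (χSplitting[dV] ∘ Ad(a ⊗ 1)) g′`: the generic
  ★ `chiSplitting_eq_conjSplitting_of_doubled` with (u1)/`hsq`/(u2) discharged by `thetaD_inlG` / `r_square` /
  ★ `omega_undoubleIdx_tensorToSum_of_mem_adelicMpTheta` at the Θ-fixing triple `(undoubleIdx r^𝔻, r, r⁻)` (`B := ω(r⁻)`);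
  **`omega_rKron_chiSplitting`** — the Kronecker operator identity
  `ω(rKron) (R_e⁻¹ (ω(χSplitting[dV′] g′) (R_e Ψ))) = R_e⁻¹ (ω(χSplitting[dV] (Ad(a ⊗ 1) g′)) (R_e (ω(rKron) Ψ)))`.
* §4 **`hω_of_T4`** — the same at the SOCKET datum of the frame-independence contract for `ω(μ,ε,χ)`
  (`chiSplittingFrameTransport_of_model_pieces`, clause `hω`): `M := 1`, `a := aOfB L B = B⁻¹ ⊗ 1` for a rational isometry `B`
  (`hB : formCongr c̄ B (1 • diag dV′) = diag dV`), binder order `p′ Ψ`, the (T4) equality as the named hypothesis `hT4`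
  (discharged in the (T4) lineage: `conjSplitting_doubledWeilRep_comp_thetaD`).

Theorems only (no definition, no named fact); default heartbeats.  Phase-A bytes of record:
`A-plan/gs6-glue/T-hOmegaOfT4.body.A-p18g9.lean` sha16 b42ece39d5c1cd7b (A-p18 g9) §3–§4, declarations byte-identical.
HC_CM is proved only modulo the 7 printed citations until rung 0 closes.

## References

* [Kudla1994] S. S. Kudla, *Splitting metaplectic covers of dual reductive pairs*, Israel J. Math. 87 (1994) 361–401, §2 (the doubled
  space and its Siegel parabolic), Thm. 3.1.
* [Kudla1984] S. Kudla, *Seesaw dual reductive pairs*, Progr. Math. 46 (1984), §1.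
* [GelbartRogawski1991] S. Gelbart, J. Rogawski, *L-functions and Fourier–Jacobi coefficients for the unitary group U(3)*,
  Invent. Math. 105 (1991), §3.1 p. 454, Prop. 3.1.1 p. 455.
* [Weil1964] A. Weil, *Sur certains groupes d'opérateurs unitaires*, Acta Math. 111 (1964), Chap. III n° 40 p. 190, n° 41 Thm 6 p. 193.
* [Liu2021] Y. Liu, *Fourier–Jacobi cycles and arithmetic relative trace formula*, Camb. J. Math. 9 (2021), Def. 4.11 (l. 2092–2096),
  App. D §D.1 Step 2 (l. 5219).
-/

set_option autoImplicit false

noncomputable section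

open scoped Classical
open scoped Matrix Kronecker
open NumberField IsDedekindDomain
open Literature.RepresentationTheory.HeisenbergGroup
open Literature.NumberTheory.Automorphic
open Literature.NumberTheory.Weil1964
open Literature.NumberTheory.GaloisRepresentations
open Literature.RepresentationTheory.HarrisKudlaSweet1996

namespace Literature.NumberTheory.GelbartRogawski1991.GRConstruction

open UnitaryDualPair
open Literature.NumberTheory.Automorphic.UnitaryGroup
open Literature.NumberTheory.Automorphic.Liu2021.Def411WeilCarriersDoubling

section Model

variable (L : Type) [Field L] [NumberField L] [IsCMField L]
  {N M n : ℕ} (e : Fin N × Fin M ≃ Fin n)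
  (dV : Fin N → L) (hdV : ∀ i, IsCMField.complexConj L (dV i) = dV i) (hdV0 : ∀ i, dV i ≠ 0)
  (dV' : Fin N → L) (hdV' : ∀ i, IsCMField.complexConj L (dV' i) = dV' i) (hdV'0 : ∀ i, dV' i ≠ 0)
  (dW : Fin M → L) (hdW : ∀ i, IsCMField.complexConj L (dW i) = dW i) (hdW0 : ∀ i, dW i ≠ 0)

/-! ## §3 The model: `rK := rKron`, `θ := Ad(a ⊗ 1)`, the (u1)/`hsq`/(u2) compatibilities discharged -/

-- (no local notation inside `variable` binders)
variable {a : GL (Fin N) (AdeleRing (𝓞 L) L)} {a₀ : GL (Fin N) L}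
  (haa₀ : (a : Matrix (Fin N) (Fin N) (AdeleRing (𝓞 L) L)) =
    ((a₀ : GL (Fin N) L) : Matrix (Fin N) (Fin N) L).map (algebraMap L (AdeleRing (𝓞 L) L)))
  (ha : ((a : Matrix (Fin N) (Fin N) (AdeleRing (𝓞 L) L)).map (conjAdele (Fp L) L (IsCMField.complexConj L)))ᵀ *
      adelicForm L N (Matrix.diagonal dV) * a = adelicForm L N (Matrix.diagonal dV'))
  {C : GL (Fin N × Fin M) (AdeleRing (𝓞 (Fp L)) (Fp L))} {C₀ : GL (Fin N × Fin M) (Fp L)}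
  (hCC₀ : (C : Matrix (Fin N × Fin M) (Fin N × Fin M) (AdeleRing (𝓞 (Fp L)) (Fp L))) =
    ((C₀ : GL (Fin N × Fin M) (Fp L)) : Matrix (Fin N × Fin M) (Fin N × Fin M) (Fp L)).map
      (algebraMap (Fp L) (AdeleRing (𝓞 (Fp L)) (Fp L))))
  (hC : (realDiagonal L dV hdV).map (algebraMap (Fp L) (AdeleRing (𝓞 (Fp L)) (Fp L))) ⊗ₖ
        (realDiagonal L dW hdW).map (algebraMap (Fp L) (AdeleRing (𝓞 (Fp L)) (Fp L))) *
      (C : Matrix (Fin N × Fin M) (Fin N × Fin M) (AdeleRing (𝓞 (Fp L)) (Fp L))) =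
    (realDiagonal L dV' hdV').map (algebraMap (Fp L) (AdeleRing (𝓞 (Fp L)) (Fp L))) ⊗ₖ
      (realDiagonal L dW hdW).map (algebraMap (Fp L) (AdeleRing (𝓞 (Fp L)) (Fp L))))

include hdV'0 haa₀ hCC₀ in
/-- **IN THE MODEL**: from the (T4) equality at `(rD, relabCD e C, thetaD a)`,
`χSplitting[dV′] g′ = conjSplitting r (relabC e C) _ (χSplitting[dV] ∘ Ad(a ⊗ 1)) g′` — (T4u)'s `hθ / hsq / hrD` discharged by
(T1ᴰ) `thetaD_inlG` / `r_square` / §B at the Θ-fixing triple `(undoubleIdx rD, r, rneg)` over `π(undoubleIdx rD) = π(r) ⊕ π(rneg)`.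
[cite: Kudla1994, §2 (doubled space, Siegel parabolic), Thm. 3.1] [cite: Weil1964, Chap. III n° 41 Thm 6 p. 193] [cite: Kudla1984, §1] -/
theorem chiSplitting_eq_conjSplitting_model (χ : HeckeCharacter L) (hχu : χ.IsUnitary) (hχs : IsSplittingChar L 1 χ)
    (hT4 : conjSplitting (Fp L) (Fin (n + n)) (rD L e dV hdV hdV0 dV' hdV' dW hdW hdW0 haa₀ ha hCC₀ hC) (relabCD e C)
        (gramDA_mul_relabCD L e dV hdV dV' hdV' dW hdW C hC)
        ((doubledWeilRep L e dV hdV hdV0 dW hdW hdW0 χ hχu hχs).comp (thetaD L e dV hdV dV' hdV' dW hdW a ha)) =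
      doubledWeilRep L e dV' hdV' hdV'0 dW hdW hdW0 χ hχu hχs)
    (g' : adelicPair (Fp L) L (IsCMField.complexConj L) N M (Matrix.diagonal dV') (Matrix.diagonal dW)) :
    chiSplitting L e dV' hdV' hdV'0 dW hdW hdW0 χ hχu hχs g' =
      conjSplitting (Fp L) (Fin n) (r L e dV hdV hdV0 dV' hdV' dW hdW hdW0 haa₀ ha hCC₀ hC) (relabC e C)
        (gramA_mul_relabC L e dV hdV dV' hdV' dW hdW C hC)
        ((chiSplitting L e dV hdV hdV0 dW hdW hdW0 χ hχu hχs).comp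
          (adelicPairIsometryConjLeft (Fp L) L (IsCMField.complexConj L) N M a ha)) g' :=
  chiSplitting_eq_conjSplitting_of_doubled L e dV hdV hdV0 dV' hdV' hdV'0 dW hdW hdW0 χ hχu hχs
    (rD L e dV hdV hdV0 dV' hdV' dW hdW hdW0 haa₀ ha hCC₀ hC) (relabCD e C) (gramDA_mul_relabCD L e dV hdV dV' hdV' dW hdW C hC)
    (thetaD L e dV hdV dV' hdV' dW hdW a ha) hT4 (adelicPairIsometryConjLeft (Fp L) L (IsCMField.complexConj L) N M a ha)
    (thetaD_inlG a ha) (r L e dV hdV hdV0 dV' hdV' dW hdW hdW0 haa₀ ha hCC₀ hC) (relabC e C)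
    (gramA_mul_relabC L e dV hdV dV' hdV' dW hdW C hC) (r_square L e dV hdV hdV0 dV' hdV' hdV'0 dW hdW hdW0 haa₀ ha hCC₀ hC)
    (LinearMap.GeneralLinearGroup.toLinearEquiv
      ((adelicMpCont.omega (Fp L) (Fin n) (-gramA L e dV hdV dW hdW)).toHomUnits
        (rneg L e dV hdV hdV0 dV' hdV' dW hdW hdW0 haa₀ ha hCC₀ hC)))
    (omega_undoubleIdx_tensorToSum_of_mem_adelicMpTheta (rD L e dV hdV hdV0 dV' hdV' dW hdW hdW0 haa₀ ha hCC₀ hC)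
      (r L e dV hdV hdV0 dV' hdV' dW hdW hdW0 haa₀ ha hCC₀ hC) (rneg L e dV hdV hdV0 dV' hdV' dW hdW hdW0 haa₀ ha hCC₀ hC)
      (proj_undoubleIdx_rD L e dV hdV hdV0 dV' hdV' dW hdW hdW0 haa₀ ha hCC₀ hC)
      (undoubleIdx_rD_mem_adelicMpTheta L e dV hdV hdV0 dV' hdV' dW hdW hdW0 haa₀ ha hCC₀ hC)
      (r_mem_adelicMpTheta L e dV hdV hdV0 dV' hdV' dW hdW hdW0 haa₀ ha hCC₀ hC)
      (rneg_mem_adelicMpTheta L e dV hdV hdV0 dV' hdV' dW hdW hdW0 haa₀ ha hCC₀ hC) hdV0 hdW0)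
    g'

include hdV'0 haa₀ hCC₀ in
/-- **`hω` IN THE LANE CURRENCY, at the Kronecker index with `rKron`**: for all `g′`, `Ψ`,
`ω(rKron) (R_e⁻¹ (ω(χSplitting[dV′] g′) (R_e Ψ))) = R_e⁻¹ (ω(χSplitting[dV] (Ad(a ⊗ 1) g′)) (R_e (ω(rKron) Ψ)))`.
[cite: GelbartRogawski1991, §3.1 Prop. 3.1.1 p. 455, p. 454] [cite: Kudla1994, §2 (doubled space, Siegel parabolic), Thm. 3.1] -/
theorem omega_rKron_chiSplitting (χ : HeckeCharacter L) (hχu : χ.IsUnitary) (hχs : IsSplittingChar L 1 χ)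
    (hT4 : conjSplitting (Fp L) (Fin (n + n)) (rD L e dV hdV hdV0 dV' hdV' dW hdW hdW0 haa₀ ha hCC₀ hC) (relabCD e C)
        (gramDA_mul_relabCD L e dV hdV dV' hdV' dW hdW C hC)
        ((doubledWeilRep L e dV hdV hdV0 dW hdW hdW0 χ hχu hχs).comp (thetaD L e dV hdV dV' hdV' dW hdW a ha)) =
      doubledWeilRep L e dV' hdV' hdV'0 dW hdW hdW0 χ hχu hχs)
    (g' : adelicPair (Fp L) L (IsCMField.complexConj L) N M (Matrix.diagonal dV') (Matrix.diagonal dW))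
    (Ψ : piSchwartzBruhat (Fp L) (Fin N × Fin M)) :
    adelicMpCont.omega (Fp L) (Fin N × Fin M) _ (rKron L dV hdV hdV0 dV' hdV' dW hdW hdW0 haa₀ ha hCC₀ hC)
        ((piSBReindex (Fp L) e).symm (adelicMpCont.omega (Fp L) (Fin n) (gramA L e dV' hdV' dW hdW)
          (chiSplitting L e dV' hdV' hdV'0 dW hdW hdW0 χ hχu hχs g') (piSBReindex (Fp L) e Ψ))) =
      (piSBReindex (Fp L) e).symm (adelicMpCont.omega (Fp L) (Fin n) (gramA L e dV hdV dW hdW)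
        (chiSplitting L e dV hdV hdV0 dW hdW hdW0 χ hχu hχs (adelicPairIsometryConjLeft (Fp L) L (IsCMField.complexConj L) N M a ha g'))
        (piSBReindex (Fp L) e (adelicMpCont.omega (Fp L) (Fin N × Fin M) _
          (rKron L dV hdV hdV0 dV' hdV' dW hdW hdW0 haa₀ ha hCC₀ hC) Ψ))) :=
  omega_kron_chiSplitting_of_eq_conjSplitting L e dV hdV hdV0 dV' hdV' hdV'0 dW hdW hdW0 χ hχu hχs
    (adelicPairIsometryConjLeft (Fp L) L (IsCMField.complexConj L) N M a ha)
    (rKron L dV hdV hdV0 dV' hdV' dW hdW hdW0 haa₀ ha hCC₀ hC) (relabC e C) (gramA_mul_relabC L e dV hdV dV' hdV' dW hdW C hC)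
    (chiSplitting_eq_conjSplitting_model L e dV hdV hdV0 dV' hdV' hdV'0 dW hdW hdW0 haa₀ ha hCC₀ hC χ hχu hχs hT4) g' Ψ

end Model

/-! ## §4 The contract clause `hω_of_T4` at the socket datum: `M := 1`, `a := aOfB L B = B⁻¹ ⊗ 1`, binder order `p′ Ψ`
(the `hω` clause of `chiSplittingFrameTransport_of_model_pieces`) -/

section Contract

variable (L : Type) [Field L] [NumberField L] [IsCMField L]
  {N n : ℕ} (e : Fin N × Fin 1 ≃ Fin n)
  (dV : Fin N → L) (hdV : ∀ i, IsCMField.complexConj L (dV i) = dV i) (hdV0 : ∀ i, dV i ≠ 0)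
  (dV' : Fin N → L) (hdV' : ∀ i, IsCMField.complexConj L (dV' i) = dV' i) (hdV'0 : ∀ i, dV' i ≠ 0)
  (dW : Fin 1 → L) (hdW : ∀ i, IsCMField.complexConj L (dW i) = dW i) (hdW0 : ∀ i, dW i ≠ 0)
  (B : GL (Fin N) L)
  (hB : formCongr ((IsCMField.complexConj L : L ≃ₐ[Fp L] L) : L →+* L) B ((1 : L) • Matrix.diagonal dV') =
    Matrix.diagonal dV)
  {C : GL (Fin N × Fin 1) (AdeleRing (𝓞 (Fp L)) (Fp L))} {C₀ : GL (Fin N × Fin 1) (Fp L)}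
  (hCC₀ : (C : Matrix (Fin N × Fin 1) (Fin N × Fin 1) (AdeleRing (𝓞 (Fp L)) (Fp L))) =
    ((C₀ : GL (Fin N × Fin 1) (Fp L)) : Matrix (Fin N × Fin 1) (Fin N × Fin 1) (Fp L)).map
      (algebraMap (Fp L) (AdeleRing (𝓞 (Fp L)) (Fp L))))
  (hC : (realDiagonal L dV hdV).map (algebraMap (Fp L) (AdeleRing (𝓞 (Fp L)) (Fp L))) ⊗ₖ
        (realDiagonal L dW hdW).map (algebraMap (Fp L) (AdeleRing (𝓞 (Fp L)) (Fp L))) *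
      (C : Matrix (Fin N × Fin 1) (Fin N × Fin 1) (AdeleRing (𝓞 (Fp L)) (Fp L))) =
    (realDiagonal L dV' hdV').map (algebraMap (Fp L) (AdeleRing (𝓞 (Fp L)) (Fp L))) ⊗ₖ
      (realDiagonal L dW hdW).map (algebraMap (Fp L) (AdeleRing (𝓞 (Fp L)) (Fp L))))
  (χ : HeckeCharacter L) (hχu : χ.IsUnitary) (hχs : IsSplittingChar L 1 χ)

include hdV'0 hCC₀ in
/-- **(4) `hω_of_T4` — THE FOURTH CLAUSE OF THE (T) CONTRACT FROM THE (T4) EQUALITY.**  Socket datum: frames `dV, dV′`, a rational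
isometry `B` (`hB`), the W-line frame `dW : Fin 1 → L`, `a := aOfB L B = B⁻¹ ⊗ 1`, a rational relabelling `C` (`hCC₀`, `hC`), and
`χ`.  IF the (T4) equality holds at the model datum — `conjSplitting r^𝔻 (relabCD e C) _ (doubledWeilRep[dV] χ ∘ θ^𝔻) =
doubledWeilRep[dV′] χ` with `r^𝔻 = rD …`, `θ^𝔻 = thetaD … (aOfB L B) …` (B-p08 (T4)/(T4c) `conjSplitting_doubledWeilRep_comp_eq_of_finPart`
at `hθsq := thetaD_square`, `hθΔ := isSiegelDelta_thetaD`, `hθdet := detDelta_thetaD…`, `hpar := hpar_rD`, `θf := thetaF`,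
`hθf := thetaD_finAdelicToAdelic`) — THEN for all `p′ ∈ U(diag dV′ ⊗ diag dW)(𝔸)` and `Ψ ∈ 𝒮(𝔸^{N×1})`:
`ω(rKron) (R_e⁻¹ (ω(χSplitting[dV′] p′) (R_e Ψ))) = R_e⁻¹ (ω(χSplitting[dV] (Ad(a ⊗ 1) p′)) (R_e (ω(rKron) Ψ)))`.
[cite: GelbartRogawski1991, §3.1 Prop. 3.1.1 p. 455, p. 454] [cite: Kudla1994, §2 (doubled space, Siegel parabolic), Thm. 3.1]
[cite: Weil1964, Chap. III n° 40–41 pp. 190–193] [cite: Liu2021, Def. 4.11 (l. 2092–2096); App. D §D.1 Step 2 (l. 5219)] -/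
theorem hω_of_T4
    (hT4 : conjSplitting (Fp L) (Fin (n + n))
        (rD L e dV hdV hdV0 dV' hdV' dW hdW hdW0 (coe_aOfB L B) (aOfB_isometry L dV dV' B hB) hCC₀ hC) (relabCD e C)
        (gramDA_mul_relabCD L e dV hdV dV' hdV' dW hdW C hC)
        ((doubledWeilRep L e dV hdV hdV0 dW hdW hdW0 χ hχu hχs).comp
          (thetaD L e dV hdV dV' hdV' dW hdW (aOfB L B) (aOfB_isometry L dV dV' B hB))) =
      doubledWeilRep L e dV' hdV' hdV'0 dW hdW hdW0 χ hχu hχs) :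
    ∀ (p' : adelicPair (Fp L) L (IsCMField.complexConj L) N 1 (Matrix.diagonal dV') (Matrix.diagonal dW))
      (Ψ : piSchwartzBruhat (Fp L) (Fin N × Fin 1)),
      adelicMpCont.omega (Fp L) (Fin N × Fin 1) _
          (rKron L dV hdV hdV0 dV' hdV' dW hdW hdW0 (coe_aOfB L B) (aOfB_isometry L dV dV' B hB) hCC₀ hC)
          ((piSBReindex (Fp L) e).symm (adelicMpCont.omega (Fp L) (Fin n) (gramA L e dV' hdV' dW hdW)
            (chiSplitting L e dV' hdV' hdV'0 dW hdW hdW0 χ hχu hχs p') (piSBReindex (Fp L) e Ψ))) =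
        (piSBReindex (Fp L) e).symm (adelicMpCont.omega (Fp L) (Fin n) (gramA L e dV hdV dW hdW)
          (chiSplitting L e dV hdV hdV0 dW hdW hdW0 χ hχu hχs
            (adelicPairIsometryConjLeft (Fp L) L (IsCMField.complexConj L) N 1 (aOfB L B) (aOfB_isometry L dV dV' B hB) p'))
          (piSBReindex (Fp L) e (adelicMpCont.omega (Fp L) (Fin N × Fin 1) _
            (rKron L dV hdV hdV0 dV' hdV' dW hdW hdW0 (coe_aOfB L B) (aOfB_isometry L dV dV' B hB) hCC₀ hC) Ψ))) :=
  fun p' Ψ => omega_rKron_chiSplitting L e dV hdV hdV0 dV' hdV' hdV'0 dW hdW hdW0 (coe_aOfB L B)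
    (aOfB_isometry L dV dV' B hB) hCC₀ hC χ hχu hχs hT4 p' Ψ

end Contract

end Literature.NumberTheory.GelbartRogawski1991.GRConstruction

end
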